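import Literature.Barriers.CriticalPhenomena.GaussianDominationRouteConvolution
import HarnessLib

/-!
# Towards `HaraSlade1990_infraredBound_holds`, VII: the cosine convolution theorem on `ℤ^d`

Sibling proof file of `GaussianDominationRoute*.lean` (barrier catalogue
`Literature/Barriers/CriticalPhenomena/`): the Fourier step "(6.1.2) can be solved to give
(6.1.3)" of Heydenreich–van der Hofstad — `τ̂ = 1 + 2dpD̂τ̂ + 2dp Π̂ D̂ τ̂ + Π̂` from
`τ = δ + J⋆τ + Π⋆J⋆τ + Π` — needs the convolution theorem for the cosine transform `cosFT` of
summable functions on `ℤ^d`, one of which is symmetric. Everything is written with explicit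
`tsum`s (`(f ⋆ g)(x) = Σ_u f(u) g(x - u)`); no convolution object is introduced.

* `tsum_cos_kdot_mul_shift_sub` / `_add` — `Σ_x cos(k·x) g(x ∓ u) = cos(k·u) ĝ(k)` for symmetric
  summable `g` (the sine part cancels, `tsum_sin_kdot_mul_eq_zero`);
* `summable_uncurry_abs_conv`, `summable_conv`, `tsum_abs_conv_le` — `ℓ¹ ⋆ ℓ¹ ⊆ ℓ¹` with
  `Σ_x |(f⋆g)(x)| ≤ (Σ|f|)(Σ|g|)` (Tonelli, `summable_prod_of_nonneg`);
* `cosFT_conv` — **`(f ⋆ g)^(k) = f̂(k) ĝ(k)`** for summable `f` and symmetric summable `g`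
  (Fubini, `Summable.tsum_comm`);
* `cosFT_nnShiftSum` — `Σ_x cos(k·x) Σⱼ [h(x - eⱼ) + h(x + eⱼ)] = 2d D̂(k) ĥ(k)` for symmetric
  summable `h` (so `(J ⋆ τ_p)^ = 2dp D̂ τ̂_p` for `J = p 𝟙{|x| = 1}`, (6.2.1)).

## References

* M. Heydenreich, R. van der Hofstad, *Progress in High-Dimensional Percolation and Random
  Graphs* (Springer 2017): (6.1.1)–(6.1.3), (6.2.1)–(6.2.2), (5.1.7) (`(f⋆g)^ = f̂ ĝ`).
-/

noncomputable section

namespace Literature.Barriers.CriticalPhenomena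

open MeasureTheory Filter Topology Literature.Probability.LatticeModels Literature.Probability.Percolation
open scoped BigOperators

variable {d : ℕ}

/-! ### Shifts -/

/-- `Σ_x cos(k·x) g(x - u) = cos(k·u) ĝ(k)` for symmetric summable `g`.
[cite: HeydenreichVanDerHofstad2017, (5.1.7) (Fourier transform of a shift / convolution)] -/
theorem tsum_cos_kdot_mul_shift_sub {g : Site d → ℝ} (hg : Summable g) (hsym : ∀ x, g (-x) = g x)
    (k : Fin d → ℝ) (u : Site d) :
    ∑' x, Real.cos (kdot k x) * g (x - u) = Real.cos (kdot k u) * cosFT g k := by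
  rw [tsum_mul_shift_sub]
  have hcs : Summable fun x => Real.cos (kdot k x) * g x := summable_cos_kdot_mul hg k
  have hss : Summable fun x => Real.sin (kdot k x) * g x :=
    (summable_mul_of_abs_le hg 1 fun x => Real.abs_sin_le_one (kdot k x)).congr fun x => by ring
  have e : (fun y : Site d => Real.cos (kdot k (y + u)) * g y) =
      fun y => Real.cos (kdot k u) * (Real.cos (kdot k y) * g y) -
        Real.sin (kdot k u) * (Real.sin (kdot k y) * g y) := by
    funext y; rw [kdot_add, Real.cos_add]; ring
  rw [e, (hcs.mul_left _).tsum_sub (hss.mul_left _), tsum_mul_left, tsum_mul_left,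
    tsum_sin_kdot_mul_eq_zero hsym, mul_zero, sub_zero, cosFT]

/-- `Σ_x cos(k·x) g(x + u) = cos(k·u) ĝ(k)` for symmetric summable `g`.
[cite: HeydenreichVanDerHofstad2017, (5.1.7)] -/
theorem tsum_cos_kdot_mul_shift_add {g : Site d → ℝ} (hg : Summable g) (hsym : ∀ x, g (-x) = g x)
    (k : Fin d → ℝ) (u : Site d) :
    ∑' x, Real.cos (kdot k x) * g (x + u) = Real.cos (kdot k u) * cosFT g k := by
  have h := tsum_cos_kdot_mul_shift_sub hg hsym k (-u)
  simp only [sub_neg_eq_add, kdot_neg, Real.cos_neg] at h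
  exact h

/-! ### `ℓ¹ ⋆ ℓ¹ ⊆ ℓ¹` -/

/-- `Σ_x |g(x - u)| = Σ_y |g(y)|`. [folklore] -/
theorem tsum_abs_shift_sub (g : Site d → ℝ) (u : Site d) :
    ∑' x, |g (x - u)| = ∑' y, |g y| := by
  have h := tsum_mul_shift_sub (fun _ => (1 : ℝ)) (fun y => |g y|) u
  simpa using h

/-- The family `(u, x) ↦ |f(u)| |g(x - u)|` is summable on `ℤ^d × ℤ^d` for summable `f, g`
(Tonelli: the `u`-th row sums to `|f(u)| Σ|g|`). [folklore] -/
theorem summable_uncurry_abs_conv {f g : Site d → ℝ} (hf : Summable f) (hg : Summable g) :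
    Summable fun p : Site d × Site d => |f p.1| * |g (p.2 - p.1)| := by
  refine (summable_prod_of_nonneg fun p => by positivity).2 ⟨fun u => ?_, ?_⟩
  · exact ((hg.comp_injective (sub_left_injective (b := u))).abs.mul_left (|f u|)).congr
      fun x => rfl
  · have e : (fun u => ∑' x, |f u| * |g (x - u)|) = fun u => |f u| * ∑' y, |g y| := by
      funext u
      rw [tsum_mul_left, tsum_abs_shift_sub]
    rw [e]
    exact hf.abs.mul_right _

/-- The family `(u, x) ↦ F(x) f(u) g(x - u)` is summable on `ℤ^d × ℤ^d` for bounded `F` and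
summable `f, g`. [folklore] -/
theorem summable_uncurry_conv {f g : Site d → ℝ} (hf : Summable f) (hg : Summable g)
    {F : Site d → ℝ} (hF : ∀ x, |F x| ≤ 1) :
    Summable (Function.uncurry fun (u x : Site d) => F x * (f u * g (x - u))) := by
  refine Summable.of_norm_bounded (summable_uncurry_abs_conv hf hg) fun p => ?_
  rw [Function.uncurry_apply_pair, Real.norm_eq_abs, abs_mul, abs_mul]
  calc |F p.2| * (|f p.1| * |g (p.2 - p.1)|) ≤ 1 * (|f p.1| * |g (p.2 - p.1)|) :=
        mul_le_mul_of_nonneg_right (hF p.2) (by positivity)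
    _ = |f p.1| * |g (p.2 - p.1)| := one_mul _

/-- **`ℓ¹ ⋆ ℓ¹ ⊆ ℓ¹`**: `x ↦ (f ⋆ g)(x) = Σ_u f(u) g(x - u)` is summable, and so is
`x ↦ F(x) (f⋆g)(x)` for bounded `F`. [folklore] -/
theorem summable_mul_conv {f g : Site d → ℝ} (hf : Summable f) (hg : Summable g)
    {F : Site d → ℝ} (hF : ∀ x, |F x| ≤ 1) :
    Summable fun x => F x * ∑' u, f u * g (x - u) := by
  have h := (summable_uncurry_conv hf hg hF).prod_symm.prod
  refine h.congr fun x => ?_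
  show ∑' u, F x * (f u * g (x - u)) = F x * ∑' u, f u * g (x - u)
  exact tsum_mul_left

/-- `(f ⋆ g)` is summable. [folklore] -/
theorem summable_conv {f g : Site d → ℝ} (hf : Summable f) (hg : Summable g) :
    Summable fun x => ∑' u, f u * g (x - u) := by
  have h := summable_mul_conv hf hg (F := fun _ => (1 : ℝ)) fun x => by simp
  exact h.congr fun x => one_mul _

/-- `Σ_x |(f ⋆ g)(x)| ≤ (Σ |f|)(Σ |g|)`. [folklore] -/
theorem tsum_abs_conv_le {f g : Site d → ℝ} (hf : Summable f) (hg : Summable g) :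
    ∑' x, |∑' u, f u * g (x - u)| ≤ (∑' u, |f u|) * ∑' y, |g y| := by
  have hG : Summable (Function.uncurry fun (u x : Site d) => |f u| * |g (x - u)|) :=
    (summable_uncurry_abs_conv hf hg).congr fun p => rfl
  have h1 : ∀ x, |∑' u, f u * g (x - u)| ≤ ∑' u, |f u| * |g (x - u)| := fun x => by
    have hsx : Summable fun u => |f u| * |g (x - u)| := hG.prod_symm.prod_factor x
    have hs : Summable fun u => f u * g (x - u) :=
      Summable.of_norm_bounded hsx fun u => by rw [Real.norm_eq_abs, abs_mul]
    calc |∑' u, f u * g (x - u)| = ‖∑' u, f u * g (x - u)‖ := (Real.norm_eq_abs _).symm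
      _ ≤ ∑' u, ‖f u * g (x - u)‖ := norm_tsum_le_tsum_norm (by simpa [Real.norm_eq_abs, abs_mul] using hsx)
      _ = ∑' u, |f u| * |g (x - u)| := tsum_congr fun u => by rw [Real.norm_eq_abs, abs_mul]
  calc ∑' x, |∑' u, f u * g (x - u)| ≤ ∑' x, ∑' u, |f u| * |g (x - u)| :=
        Summable.tsum_le_tsum h1 ((summable_conv hf hg).abs) hG.prod_symm.prod
    _ = ∑' u, ∑' x, |f u| * |g (x - u)| := hG.tsum_comm
    _ = ∑' u, |f u| * ∑' y, |g y| := tsum_congr fun u => by rw [tsum_mul_left, tsum_abs_shift_sub]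
    _ = (∑' u, |f u|) * ∑' y, |g y| := tsum_mul_right

/-! ### The convolution theorem -/

/-- **Cosine convolution theorem on `ℤ^d`**: for summable `f` and symmetric summable `g`,
`Σ_x cos(k·x) (f ⋆ g)(x) = f̂(k) ĝ(k)` — Fubini (`ℓ¹ ⋆ ℓ¹`), then
`Σ_x cos(k·x) g(x - u) = cos(k·u) ĝ(k)`. [cite: HeydenreichVanDerHofstad2017, (5.1.7) and (6.1.2)–(6.1.3)] -/
theorem cosFT_conv {f g : Site d → ℝ} (hf : Summable f) (hg : Summable g) (hsym : ∀ x, g (-x) = g x)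
    (k : Fin d → ℝ) :
    cosFT (fun x => ∑' u, f u * g (x - u)) k = cosFT f k * cosFT g k := by
  have hunc := summable_uncurry_conv hf hg (F := fun x => Real.cos (kdot k x))
    fun x => Real.abs_cos_le_one _
  unfold cosFT
  calc ∑' x, Real.cos (kdot k x) * ∑' u, f u * g (x - u)
      = ∑' x, ∑' u, Real.cos (kdot k x) * (f u * g (x - u)) := tsum_congr fun x => by rw [tsum_mul_left]
    _ = ∑' u, ∑' x, Real.cos (kdot k x) * (f u * g (x - u)) := hunc.tsum_comm
    _ = ∑' u, f u * (Real.cos (kdot k u) * ∑' x, Real.cos (kdot k x) * g x) := by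
        refine tsum_congr fun u => ?_
        rw [show Real.cos (kdot k u) * ∑' x, Real.cos (kdot k x) * g x =
          ∑' x, Real.cos (kdot k x) * g (x - u) from (tsum_cos_kdot_mul_shift_sub hg hsym k u).symm,
          ← tsum_mul_left]
        exact tsum_congr fun x => by ring
    _ = (∑' u, Real.cos (kdot k u) * f u) * ∑' x, Real.cos (kdot k x) * g x := by
        rw [← tsum_mul_right]
        exact tsum_congr fun u => by ring

/-- **`(J ⋆ h)^ = 2d D̂ ĥ`** in the explicit nearest-neighbour form: for symmetric summable `h`
(and `d ≥ 1`), `Σ_x cos(k·x) Σⱼ [h(x - eⱼ) + h(x + eⱼ)] = 2d D̂(k) ĥ(k)`.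
[cite: HeydenreichVanDerHofstad2017, (6.2.1) and (6.1.1)–(6.1.3) (J = 2dpD, Ĵ = 2dp D̂)] -/
theorem cosFT_nnShiftSum [NeZero d] {h : Site d → ℝ} (hh : Summable h) (hsym : ∀ x, h (-x) = h x)
    (k : Fin d → ℝ) :
    cosFT (fun x => ∑ j : Fin d, (h (x - Pi.single j 1) + h (x + Pi.single j 1))) k =
      2 * d * Dhat d k * cosFT h k := by
  have hd : (d : ℝ) ≠ 0 := by exact_mod_cast NeZero.ne d
  have hcos1 : ∀ x : Site d, |Real.cos (kdot k x)| ≤ 1 := fun x => Real.abs_cos_le_one _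
  have hC : ∀ j : Fin d, Summable fun x : Site d => Real.cos (kdot k x) * h (x - Pi.single j 1) :=
    fun j => summable_mul_shift_sub hh hcos1 _
  have hD : ∀ j : Fin d, Summable fun x : Site d => Real.cos (kdot k x) * h (x + Pi.single j 1) :=
    fun j => summable_mul_shift_add hh hcos1 _
  unfold cosFT
  calc ∑' x, Real.cos (kdot k x) * ∑ j : Fin d, (h (x - Pi.single j 1) + h (x + Pi.single j 1))
      = ∑' x, ∑ j : Fin d, (Real.cos (kdot k x) * h (x - Pi.single j 1) +
          Real.cos (kdot k x) * h (x + Pi.single j 1)) := tsum_congr fun x => by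
        rw [Finset.mul_sum]
        exact Finset.sum_congr rfl fun j _ => by ring
    _ = ∑ j : Fin d, ∑' x, (Real.cos (kdot k x) * h (x - Pi.single j 1) +
          Real.cos (kdot k x) * h (x + Pi.single j 1)) :=
        Summable.tsum_finsetSum fun j _ => (hC j).add (hD j)
    _ = ∑ j : Fin d, 2 * Real.cos (k j) * ∑' x, Real.cos (kdot k x) * h x := by
        refine Finset.sum_congr rfl fun j _ => ?_
        rw [(hC j).tsum_add (hD j), tsum_cos_kdot_mul_shift_sub hh hsym, tsum_cos_kdot_mul_shift_add hh hsym,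
          kdot_single_one, cosFT]
        ring
    _ = 2 * d * Dhat d k * ∑' x, Real.cos (kdot k x) * h x := by
        rw [Dhat, ← Finset.sum_mul, ← Finset.mul_sum]
        field_simp

end Literature.Barriers.CriticalPhenomena

end
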